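import Literature.NumberTheory.EllipticCurves.CanonicalPAdicHeightRestrictionProofs
import Literature.NumberTheory.EllipticCurves.PadicSigmaSq
import HarnessLib

/-!
# The canonical `p`-adic height over `K`, sigma-SQUARED form, restricts to `[K:ℚ]` times the one
# over `ℚ` — at every prime, `p = 2` included (proofs only)

Trunk T-NT-EC (`Literature/NumberTheory/EllipticCurves`). Pure proof file (no definitions, no named
facts): the Σ-twin of `CanonicalPAdicHeightRestrictionProofs.lean` (which proves
`isCanonicalK_restrictsTo` for the σ-form, stated for `p ≥ 5`). For the sigma-squared receptacles of
`PadicSigmaSq.lean` — `canonicalPAdicHeightSq W p P = log_p den x − log_p Σ_p(z(P))`,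
`canonicalPAdicHeightSqK W p K P = log_p N𝔡(x) − Σ_ι log_p Σ_p(z(ιP))`, `PAdicHeightData.IsCanonicalSq`,
`PAdicHeightDataK.IsCanonicalSq` — the same bookkeeping holds with NO hypothesis on the prime:

* `canonicalPAdicHeightSqK_pointToBaseChange` — for `p` totally split in `K` and `P ∈ E(ℚ)`:
  `ĥ^Σ_{p,K}(ιP) = [K:ℚ]·ĥ^Σ_p(P)` (`N𝔡_K(x) = (den x)^{[K:ℚ]}`, `log_p` of a power, and each of the
  `[K:ℚ]` embeddings sees the same `p`-adic point);
* `PAdicHeightDataK.IsCanonicalSq.restrictsTo` — for `W` globally minimal, every `K`-datum `DK` with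
  `DK.IsCanonicalSq` and every `ℚ`-datum `D` with `D.IsCanonicalSq` satisfy `DK.RestrictsTo D`:
  `⟨ιP, ιQ⟩_K = [K:ℚ]·⟨P, Q⟩` on `E(ℚ)` — both sides are symmetric bilinear torsion-vanishing pairings
  on `E(ℚ)` agreeing on admissible `Q` (`isAdmissibleK_pointToBaseChange`), and admissible multiples
  exist (`exists_admissible_nsmul_holds`); in particular at `p = 2` (where the data exist by
  `exists_isCanonicalSq_two` / `exists_isCanonicalSqK_two`) the `2`-adic regulators over `K = ℚ(√−7)`
  and over `ℚ` are related by the factor `[K:ℚ] = 2` per pairing value, as in the odd case.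

This is the `R_p(E/K)` versus `R_p(E/ℚ)` bookkeeping of Mazur–Stein–Tate 2006 §2.8
(`ρ^K_cycl = ρ^ℚ_cycl ∘ N_{K/ℚ}`) / Perrin-Riou 1987 §1.2, for the squared form. Nothing is asserted.

## Sources

* B. Mazur, W. Stein, J. Tate, Doc. Math. Extra Vol. Coates (2006), §2.8.
* J. S. Balakrishnan, M. Çiperiani, W. Stein, Math. Comp. 84 (2015), §4.1 eq. (4.1).
* B. Perrin-Riou, Invent. Math. 89 (1987), §1.2.
-/

noncomputable section

open scoped Classical
open IsDedekindDomain NumberField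

namespace WeierstrassCurve

open Literature.NumberTheory.EllipticCurves

variable (K : Type) [Field K] [NumberField K] (W : WeierstrassCurve ℚ) (p : ℕ) [Fact p.Prime]

/-- **The sigma-squared formula over `K` at a rational point.** If `p` is totally split in `K`
(`#(K → ℚ_p) = [K:ℚ]`), then for `P ∈ E(ℚ)`,
`ĥ^Σ_{p,K}(ιP) = log_p N(𝔡_K(x)) − Σ_ι log_p Σ_p(z(ιP)) = [K:ℚ]·ĥ^Σ_p(P)`: `N(𝔡_K(x)) = (den x)^{[K:ℚ]}`,
`log_p` of a power, and each of the `[K:ℚ]` embeddings sees the same `p`-adic point. Any prime `p`.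
[Balakrishnan–Çiperiani–Stein 2015, §4.1 eq. (4.1); Mazur–Stein–Tate 2006, §2.8
(`ρ^K_cycl = ρ^ℚ_cycl ∘ N_{K/ℚ}`)] [cite: MazurSteinTate2006, §2.8] -/
theorem canonicalPAdicHeightSqK_pointToBaseChange
    (hcard : Fintype.card (K →+* ℚ_[p]) = Module.finrank ℚ K) (P : W.toAffine.Point) :
    W.canonicalPAdicHeightSqK p K (W.pointToBaseChange K P) =
      (Module.finrank ℚ K : ℚ_[p]) * W.canonicalPAdicHeightSq p P := by
  rcases P with _ | ⟨x, y, h⟩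
  · simp [canonicalPAdicHeightSqK, canonicalPAdicHeightSq, pointToBaseChange]
  · simp only [pointToBaseChange, canonicalPAdicHeightSqK, canonicalPAdicHeightSq]
    rw [absNorm_denominatorIdeal_algebraMap]
    simp only [eq_ratCast, map_ratCast, Finset.sum_const, Finset.card_univ, hcard, nsmul_eq_mul]
    have hd : ((x.den : ℚ) : ℚ_[p]) ≠ 0 := by exact_mod_cast x.den_nz
    have hpow : (((x.den ^ Module.finrank ℚ K : ℕ) : ℚ) : ℚ_[p]) =
        ((x.den : ℚ) : ℚ_[p]) ^ Module.finrank ℚ K := by push_cast; rfl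
    rw [hpow, padicLog_pow p hd]
    ring

variable {K W p} in
/-- **A `K`-datum and a `ℚ`-datum that are canonical in sigma-squared form are compatible under
restriction, at every prime**: for `E/ℚ` with globally minimal `W`, a number field `K`, any prime
`p`, `DK` with `DK.IsCanonicalSq` (`p` totally split, `⟨P,P⟩ = ĥ^Σ_{p,K}(P)` on `K`-admissible points)
and `D` with `D.IsCanonicalSq`: `⟨ιP, ιQ⟩_K = [K:ℚ]·⟨P, Q⟩` for all `P, Q ∈ E(ℚ)` (`DK.RestrictsTo D`).
Proof as for `isCanonicalK_restrictsTo_holds`: both sides are symmetric bilinear torsion-vanishing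
pairings on `E(ℚ)`; on an admissible `Q` they are `ĥ^Σ_{p,K}(ιQ)` (`ιQ` is `K`-admissible,
`isAdmissibleK_pointToBaseChange`) and `[K:ℚ]·ĥ^Σ_p(Q)`, which agree
(`canonicalPAdicHeightSqK_pointToBaseChange`); admissible multiples exist
(`exists_admissible_nsmul_holds`), so the pairings coincide (`pairing_eq_of_sq_eq_on`). At `p = 2`
this relates the `2`-adic height data of `exists_isCanonicalSqK_two` and `exists_isCanonicalSq_two`.
[Balakrishnan–Çiperiani–Stein 2015, §4.1; Mazur–Stein–Tate 2006, §2.8; Perrin-Riou 1987, §1.2]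
[cite: MazurSteinTate2006, §2.8] [cite: PerrinRiou1987, §1.2] -/
theorem PAdicHeightDataK.IsCanonicalSq.restrictsTo [W.IsElliptic] [W.IsGloballyMinimal]
    {DK : PAdicHeightDataK W p K} {D : PAdicHeightData W p} (hDK : DK.IsCanonicalSq)
    (hD : D.IsCanonicalSq) : DK.RestrictsTo D := by
  set ι : W.toAffine.Point →+ (W.baseChange K).toAffine.Point :=
    Affine.Point.map (W' := W) (F := ℚ) (Algebra.ofId ℚ K)
  have hι : ∀ P, ι P = W.pointToBaseChange K P := fun P => by
    rcases P with _ | ⟨x, y, h⟩ <;> rfl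
  set B₁ : W.toAffine.Point →+ W.toAffine.Point →+ ℚ_[p] := (DK.pairing.comp ι).compl₂ ι
  set B₂ : W.toAffine.Point →+ W.toAffine.Point →+ ℚ_[p] :=
    D.pairing.compr₂ (AddMonoidHom.mulLeft (Module.finrank ℚ K : ℚ_[p]))
  have h₁ : ∀ P Q, B₁ P Q = DK.pairing (W.pointToBaseChange K P) (W.pointToBaseChange K Q) :=
    fun P Q => by rw [← hι, ← hι]; rfl
  have h₂ : ∀ P Q, B₂ P Q = (Module.finrank ℚ K : ℚ_[p]) * D.pairing P Q := fun P Q => rfl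
  have key : B₁ = B₂ := by
    refine pairing_eq_of_sq_eq_on B₁ B₂ (fun P Q => ?_) (fun P Q => ?_) (fun P Q hP => ?_)
      (fun P Q hP => ?_) {P | W.IsAdmissible p P} (fun P hP => ?_) (fun Q hQ => ?_)
    · rw [h₁, h₁, DK.symm]
    · rw [h₂, h₂, D.symm]
    · rw [h₁]
      exact DK.map_torsion _ _ ((W.isOfFinAddOrder_pointToBaseChange_iff K P).mpr hP)
    · rw [h₂, D.map_torsion P Q hP, mul_zero]
    · exact exists_admissible_nsmul_holds W p P hP
    · rw [h₁, h₂, hDK.2 _ (W.isAdmissibleK_pointToBaseChange K hQ),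
        W.canonicalPAdicHeightSqK_pointToBaseChange K p hDK.1, hD Q hQ]
  intro P Q
  rw [← h₁, ← h₂, key]

variable {K W p} in
/-- **Quadratic form version**: under the same hypotheses `⟨ιP, ιP⟩_K = [K:ℚ]·⟨P, P⟩` for every
`P ∈ E(ℚ)` — in rank one, `Reg^Σ_p(E/K)|_{E(ℚ)} = [K:ℚ]·Reg^Σ_p(E/ℚ)` per generator.
[cite: MazurSteinTate2006, §2.8] [cite: PerrinRiou1987, §1.2] -/
theorem PAdicHeightDataK.IsCanonicalSq.pairing_pointToBaseChange_self [W.IsElliptic]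
    [W.IsGloballyMinimal] {DK : PAdicHeightDataK W p K} {D : PAdicHeightData W p}
    (hDK : DK.IsCanonicalSq) (hD : D.IsCanonicalSq) (P : W.toAffine.Point) :
    DK.pairing (W.pointToBaseChange K P) (W.pointToBaseChange K P) =
      (Module.finrank ℚ K : ℚ_[p]) * D.pairing P P :=
  hDK.restrictsTo hD P P

end WeierstrassCurve
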